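import Summits.QuantumFields.YangMills.Theorems.UnitScaleTiltProp7GreenKernelSiteFree
import HarnessLib

/-!
# Route `UnitScaleTilt`, crux K1 «MinimiserStabilityRegPr» (stmt-QuantumFields-19200), route-R E′ path (α′), (E1-b) sibling (hK₂): «THE FREE PART CONTRIBUTES EXACTLY δ» —
# for the free kernel `Gf` of ✓ `exists_green_site_split(_free)` (any `F` with the displayed row `hLf : laplace c (F x) z = (2c²)⁻¹(G̃(EK z − EK x) − G̃(EK z − EK y_c))`),
# the `x`-Laplacian of the `z`-Laplacian is the identity kernel minus the zero mode: `laplace c (x ↦ laplace c (F x) z) x₀ = 𝟙[x₀ = z] − L_T^{−d}` (`L_T = L^k·sitesPerDir k`)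

Cell `ym3-torus`, width seat `ym3-torus-px4` (gen 2); ★ym-ust-19200-p1 g15 20:45:05Z NAMER round 3 «(E1-b) (hK₀)(hK)(hK₂) [… px4]», ★routeR-w3 g5 (E1) LOCATE §3 «(hK₂) … NO log (the free part
contributes exactly δ)»; offered 20:5xZ «px4: (hK₂-FREE)».  THEOREMS ONLY (0 `def`, 0 `sorry`); `--supports stmt-QuantumFields-19200`, count-neutral.  YM₃ on T³ is a ladder rung (R3), not
the Clay problem; nothing here claims the stub, the crux, d = 4 or the gap.

WHAT IS PROVED (ns `…Theorems.Prop7GreenKernelSiteFreeLaplace`).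
* §1 (constant family `Tor (fun _ ↦ L) = TorusSite d L`, lattice constant `1`): `LapSinv_one_symm` (`Δ₁⁻¹(a,b) = Δ₁⁻¹(b,a)`, Hermitian + real), `Pker_one_apply` (`Pker(t,s) = L^{−d}`: the
  kernel of `Δ₁` is the constants), ★ `LapS_mulVec_LapSinv_row` (`(Δ₁·Δ₁⁻¹(a,·))(t) = 𝟙[t = a] − L^{−d}`, i.e. `ΔΔ⁻¹ = 1 − Pker` ✓ `LapS_mul_LapSinv` entrywise),
  ★ `laplace_one_torusGreen_EK_sub` (`laplace 1 (x ↦ G̃(EK z − EK x)) x₀ = 2·(𝟙[x₀ = z] − L_T^{−d})` on `Site P 0`).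
* §2 ★★ `laplace_laplace_free_eq_delta` — for any `F : Site P 0 → Site P 0 → ℝ` with the displayed row `hLf` (the fifth conjunct of ✓ `exists_green_site_split`), every `z x₀`:
  `laplace c (fun x ↦ laplace c (F x) z) x₀ = (if x₀ = z then 1 else 0) − ((L^k·sitesPerDir k : ℕ):ℝ)^{−P.d}`.
HONEST SCOPE.  Bookkeeping (the Poisson equation of the torus Green function read on `Site P 0`); the (hK₂) estimate for the INTERPOLANT part `Uf` is the (A) seat's.

References: T. Bałaban, CMP 95 (1984) 17–40 [Balaban1984PropagatorsI] (Sect. C p.22, (1.21) p.21); S. Friedli, Y. Velenik, *Statistical Mechanics of Lattice Systems*, CUP 2017, §8.4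
[FriedliVelenik2017].
-/

set_option autoImplicit false

noncomputable section

open scoped BigOperators Matrix ComplexConjugate Real
open Finset Complex Matrix

namespace Summit.QuantumFields.YangMills.Theorems.Prop7GreenKernelSiteFreeLaplace

open Literature.MathematicalPhysics.QuantumFieldTheory.Balaban1983to89
open LatticeFieldCalculus
open B5Prop11Plancherel B5Block118 B5LaplaceInverse B5Momentum130 B5Momentum133
open B5Action121 (LapS LapS_mulVec)
open B5Eq117TorusCarriers (Mk EK EK_apply)
open Literature.Probability.LatticeModels
open Prop7GreenKernelSiteTransport
open Prop7GreenKernelSiteFree (sandwich_apply_const)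
open Prop7TorusGreenDictionary (LapSinv_one_apply_eq_half_torusGreen LapSinv_one_apply_im lsym_one_eq_two_dispersion chi_const_eq_torusChar)

/-! ## §1 `ΔΔ⁻¹ = 1 − Pker` entrywise, for the constant family -/

section ConstFamily

variable {d L : ℕ} [NeZero L]

/-- `Δ₁⁻¹(a,b) = Δ₁⁻¹(b,a)` (Hermitian ✓ `LapSinv_conjTranspose` and real ✓ `LapSinv_one_apply_im`). [cite: Balaban1984PropagatorsI, Sect. C p.22] -/
theorem LapSinv_one_symm (a b : TorusSite d L) :
    LapSinv (fun _ : Fin d => L) (1 : ℂ) a b = LapSinv (fun _ : Fin d => L) (1 : ℂ) b a := by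
  have h := congrArg (fun M : Matrix (TorusSite d L) (TorusSite d L) ℂ => M a b) (LapSinv_conjTranspose (fun _ : Fin d => L) (1 : ℂ))
  simp only [Matrix.conjTranspose_apply, Complex.star_def] at h
  rw [← h]
  exact (Complex.conj_eq_iff_im.2 (LapSinv_one_apply_im b a))

/-- **the zero-mode projection is the constant matrix `L^{−d}`**: `Pker (fun _ ↦ L) 1 t s = L^{−d}` (`lsym 1 p = 2ε(p_p) = 0 ↔ p = 0`, `χ₀ = 1`). [cite: Balaban1984PropagatorsI, Sect. C p.22] -/
theorem Pker_one_apply (t s : TorusSite d L) :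
    Pker (fun _ : Fin d => L) (1 : ℂ) t s = ((((L : ℝ) ^ d)⁻¹ : ℝ) : ℂ) := by
  classical
  unfold Pker
  rw [sandwich_apply_const]
  have hterm : ∀ p : TorusSite d L, (if lsym (fun _ : Fin d => L) (1 : ℂ) p = 0 then (1 : ℂ) else 0) * chi (fun _ : Fin d => L) p (t - s)
      = if p = 0 then 1 else 0 := by
    intro p
    by_cases hp : p = 0
    · subst hp
      have h0 : lsym (fun _ : Fin d => L) (1 : ℂ) 0 = 0 := by
        rw [lsym_one_eq_two_dispersion]
        have : dispersion (latticeMomentum L (0 : TorusSite d L)) = 0 := by simp [dispersion, latticeMomentum]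
        rw [this]; simp
      rw [if_pos h0, if_pos rfl, one_mul]
      unfold chi
      simp
    · have hne : lsym (fun _ : Fin d => L) (1 : ℂ) p ≠ 0 := by
        rw [lsym_one_eq_two_dispersion]
        have hε := dispersion_latticeMomentum_pos hp
        exact_mod_cast (by positivity : (2 * dispersion (latticeMomentum L p)) ≠ 0)
      rw [if_neg hne, if_neg hp, zero_mul]
  rw [Finset.sum_congr rfl fun p _ => hterm p, Finset.sum_ite_eq' Finset.univ (0 : TorusSite d L)]
  simp

/-- ★ **`(Δ₁·Δ₁⁻¹(a,·))(t) = 𝟙[t = a] − L^{−d}`** — ✓ `LapS_mul_LapSinv` (`ΔΔ⁻¹ = 1 − Pker`) entrywise, with the column read as a row by `LapSinv_one_symm`.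
[cite: Balaban1984PropagatorsI, Sect. C p.22] -/
theorem LapS_mulVec_LapSinv_row (a t : TorusSite d L) :
    (LapS (fun _ : Fin d => L) (1 : ℂ) *ᵥ (fun s => LapSinv (fun _ : Fin d => L) (1 : ℂ) a s)) t
      = (if t = a then (1 : ℂ) else 0) - ((((L : ℝ) ^ d)⁻¹ : ℝ) : ℂ) := by
  have h1 : (LapS (fun _ : Fin d => L) (1 : ℂ) *ᵥ (fun s => LapSinv (fun _ : Fin d => L) (1 : ℂ) a s)) t
      = (LapS (fun _ : Fin d => L) (1 : ℂ) * LapSinv (fun _ : Fin d => L) (1 : ℂ)) t a := by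
    rw [Matrix.mul_apply]
    simp only [Matrix.mulVec, dotProduct]
    refine Finset.sum_congr rfl fun s _ => ?_
    rw [LapSinv_one_symm a s]
  rw [h1, LapS_mul_LapSinv, Matrix.sub_apply, Matrix.one_apply, Pker_one_apply]

end ConstFamily

/-! ## §2 ★★ The double Laplacian of the free kernel on `Site P 0` -/

section SiteSide

variable {P : Params} {k : ℕ}

/-- ★ **the Poisson equation of `G̃` on `Site P 0`**: `laplace 1 (x ↦ G̃(EK z − EK x)) x₀ = 2·(𝟙[x₀ = z] − L_T^{−d})` (`G̃ = 2·Δ₁⁻¹` ✓ `LapSinv_one_apply_eq_half_torusGreen`, `L_T = L^k·sitesPerDir k`).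
[cite: Balaban1984PropagatorsI, (1.21) p.21] -/
theorem laplace_one_torusGreen_EK_sub (hk : k ≤ P.m + P.K) (z x₀ : Site P 0) :
    laplace 1 (fun x : Site P 0 => torusGreen (L := P.L ^ k * P.sitesPerDir k) (EK hk z - EK hk x)) x₀
      = 2 * ((if x₀ = z then (1 : ℝ) else 0) - (((P.L ^ k * P.sitesPerDir k : ℕ) : ℝ) ^ P.d)⁻¹) := by
  classical
  haveI : NeZero (P.L ^ k * P.sitesPerDir k) := ⟨mul_ne_zero (pow_ne_zero _ P.L_pos.ne') (P.sitesPerDir_ne_zero k)⟩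
  -- `G̃(EK z − EK x) = 2·Re Δ₁⁻¹(EK z, EK x)`
  have hG : (fun x : Site P 0 => torusGreen (L := P.L ^ k * P.sitesPerDir k) (EK hk z - EK hk x))
      = fun x => 2 * (LapSinv (fine (P.L ^ k) (Mk P k)) (1 : ℂ) (EK hk z) (EK hk x - 0)).re := by
    funext x
    rw [sub_zero, LapSinv_one_apply_eq_half_torusGreen (d := P.d) (L := P.L ^ k * P.sitesPerDir k), Complex.ofReal_re]
    ring
  rw [hG, laplace_one_const_mul,
    laplace_one_re_comp_tau hk 0 (fun s => LapSinv (fine (P.L ^ k) (Mk P k)) (1 : ℂ) (EK hk z) s) x₀, sub_zero,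
    LapS_mulVec_LapSinv_row (d := P.d) (L := P.L ^ k * P.sitesPerDir k) (EK hk z) (EK hk x₀)]
  by_cases h : x₀ = z
  · subst h
    simp only [if_true, Complex.sub_re, Complex.one_re, Complex.ofReal_re]
  · have h' : EK hk x₀ ≠ EK hk z := fun e => h ((EK hk).injective e)
    rw [if_neg h', if_neg h]
    simp only [Complex.sub_re, Complex.zero_re, Complex.ofReal_re]

/-- ★★ **«THE FREE PART CONTRIBUTES EXACTLY δ»** ((hK₂)'s free-kernel row): for every `F : Site P 0 → Site P 0 → ℝ` with the displayed free-Laplacian row `hLf` of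
✓ `exists_green_site_split` and all `z, x₀`:  `laplace c (fun x ↦ laplace c (F x) z) x₀ = 𝟙[x₀ = z] − L_T^{−P.d}`  — LOCAL, no tail (the `y_c`-term is constant in `x`).
[cite: Balaban1984PropagatorsI, Sect. C p.22, (1.21) p.21] -/
theorem laplace_laplace_free_eq_delta (hk : k ≤ P.m + P.K) {c : ℝ} (hc : c ≠ 0) (F : Site P 0 → Site P 0 → ℝ) (y_c : Site P 0)
    (hLf : ∀ x z, laplace c (F x) z = (2 * c ^ 2)⁻¹ *
      (torusGreen (L := P.L ^ k * P.sitesPerDir k) (EK hk z - EK hk x) - torusGreen (L := P.L ^ k * P.sitesPerDir k) (EK hk z - EK hk y_c)))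
    (z x₀ : Site P 0) :
    laplace c (fun x : Site P 0 => laplace c (F x) z) x₀ = (if x₀ = z then (1 : ℝ) else 0) - (((P.L ^ k * P.sitesPerDir k : ℕ) : ℝ) ^ P.d)⁻¹ := by
  classical
  have hc2 : c ^ 2 ≠ 0 := pow_ne_zero _ hc
  have hfun : (fun x : Site P 0 => laplace c (F x) z)
      = fun x => (2 * c ^ 2)⁻¹ * (torusGreen (L := P.L ^ k * P.sitesPerDir k) (EK hk z - EK hk x)
          - torusGreen (L := P.L ^ k * P.sitesPerDir k) (EK hk z - EK hk y_c)) := funext fun x => hLf x z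
  have hsub : laplace 1 (fun x : Site P 0 => torusGreen (L := P.L ^ k * P.sitesPerDir k) (EK hk z - EK hk x)
      - torusGreen (L := P.L ^ k * P.sitesPerDir k) (EK hk z - EK hk y_c)) x₀
      = laplace 1 (fun x : Site P 0 => torusGreen (L := P.L ^ k * P.sitesPerDir k) (EK hk z - EK hk x)) x₀ := by
    simp only [laplace, one_pow, one_smul]
    refine Finset.sum_congr rfl fun μ _ => ?_
    ring
  rw [hfun, laplace_eq_sq_smul_laplace_one, smul_eq_mul, laplace_one_const_mul, hsub, laplace_one_torusGreen_EK_sub]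
  field_simp

end SiteSide

end Summit.QuantumFields.YangMills.Theorems.Prop7GreenKernelSiteFreeLaplace
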